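import Mathlib.Algebra.Field.ZMod
import Literature.Computability.Cryptography.LWEProductLaws
import HarnessLib

/-!
# Regev's decision-to-search reduction for LWE, I: sample layout, queries, decision rule

Topic `Computability/Cryptography` (LWE), grouping namespace `LWE.DecisionToSearch` (the
reduction of Regev 2009, §4, Lemma 4.2 composed with Lemma 4.1, analysed for
`regev_decision_to_search`, `LWEHardness.lean`). This file fixes, MACHINE-FREE, what the reduction
does with its input — one tuple of `m' = K·2m` independent samples from `A_{s,χ}` — and how it reads
the secret off the distinguisher's answer bits; the probability estimate is in part II
(`LWEDecisionToSearchAnalysis.lean`) and the polynomial-time machine computing exactly these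
queries in part III.

**Layout.** The input is cut into `K = R + (N + G·N)` consecutive *units* of `2m` samples
(`Params.units`, `blocksOf`), `G = n·B·R` (`Params.groups`): `R` *shift units* (unit `r` yields the
shift vector `t_r :=` the `a`-part of its first sample, `tOf`), `N` *uniform units* (unit `j` yields
the self-made uniform block `((a_p, (a'_p)₀))_{p<m}` from the `a`-parts of its two halves, `ublkOf` —
uniform because the `a` of `A_{s,χ}` are uniform), and for each triple `(i, k, r)` (coordinate
`i < n`, guess `k < B`, shift `r < R`; group index `g = (i·B + k)·R + r`, `Params.gOf`) `N` *test
units* (unit `(g, j)` yields the block `(f_{t_r} ∘ c_{i,k,l_p})(x_p)`, `p < m`, where `x_p` runs over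
the first half, the fresh scalars `l_p = (a'_p)₀` come from the second half, `c_{i,k,l}(a,b) =
(a + l eᵢ, b + l k)` is Regev's coordinate test of Lemma 4.2 and `f_t(a,b) = (a, b + ⟨a,t⟩)` his shift of
Lemma 4.1; `xblkOf`). The distinguisher is asked about the `N` uniform blocks (answer bits
`0 … N-1`) and the `G·N` test blocks (bit `N + g·N + j`), `Params.qry`/`Params.bitsOf`.

**Decision rule** (`Params.solveBits`, on an abstract answer sequence `bits : ℕ → Bool`, the
interface of the machine's output map): with `cU = #{j < N | bit j}` and
`cX(i,k,r) = #{j < N | bit (N + g N + j)}`, guess for coordinate `i` the least `k < B` such that for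
some `r < R` the counts are FAR, `N ≤ 4 D |cX(i,k,r) - cU|` (i.e. the empirical acceptance frequencies
differ by at least `ε/4`, `ε = 1/D`); output `(guess i : ℤ_q)ᵢ`. Regev (p. 23): "if the two
estimates differ by more than `n^{-c₂}/2` then we stop and decide to accept … using `W`, we can test
whether `k = s₁`. Since there are only `p < poly(n)` possibilities for `s₁` we can try all of them."

**Relation to `LWERegevEstimates/Core/Asymptotics.lean`** (`LWE.RegevReduction`, a parallel formalisation
of the same lemmas landed concurrently by the other seat of this item): there the reduction's
randomness (shifts `t`, scalars `l`) is drawn from its own laws (`pieceLaw`, `innerLaw`, `outerLaw` on an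
abstract sample space) and a coin tape is budgeted (`K`-bit chunks, statistical term `L q/2^K`); HERE
the reduction is COIN-FREE — `t`, `l` and the self-made uniform samples are read EXACTLY off the
`a`-parts of surplus samples of the ONE input tuple `S : Fin m' → ℤ_qⁿ × ℤ_q` (uniform and independent
under `A_{s,χ}`), so the sample space is the input law `A_{s,χ}^{m'}` itself and no sampling error
arises; and every object is indexed by flat positions of `S` (`Params.units`, unit `u` = samples
`[u·2m, (u+1)·2m)`), which is what the `FP` machine of parts III–IV computes on the code of `S`. The
two lines share only `LWERegevTransforms.lean`.

**Exact laws of the extracted blocks** (`lweSamples_map_tOf`, `lweSamples_map_ublkOf`,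
`lweSamples_map_xblkOf_self`, `lweSamples_map_xblkOf_of_ne`): under `A_{s,χ}^{2m}` a unit's shift
vector is uniform, its uniform block is `U^m`, and its test block is `A_{s+t,χ}^m` if `k = sᵢ` and
`U^m` if `k ≠ sᵢ` (`q` prime) — Regev's three claims of p. 23, through `LWERegevTransforms.lean`.

## References

* O. Regev, *On lattices, learning with errors, random linear codes, and cryptography*, J. ACM 56
  (2009), art. 34, §4, Lemmas 4.1–4.2 and their proofs (held copy arXiv:2401.03703, p. 23).
  [cite: RegevLWE2009, §4 Lemma 4.1–4.2]
-/

noncomputable section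

open scoped ENNReal

namespace Literature.Computability.Cryptography

namespace LWE

namespace DecisionToSearch

open Literature.Probability.Distributions

variable {n q m : ℕ}

/-! ### What is read off one unit of `2m` samples -/

/-- The scalar drawn from a sample: coordinate `0` of its `a`-part (junk `0` in dimension `0`).
[cite: RegevLWE2009, §4 (proof of Lemma 4.2: "`l ∈ ℤ_p` chosen uniformly at random")] -/
def scal (x : (Fin n → ZMod q) × ZMod q) : ZMod q :=
  if h : 0 < n then x.1 ⟨0, h⟩ else 0

/-- The shift vector of a unit: the `a`-part of its first sample (junk `0` if `m = 0`).
[cite: RegevLWE2009, §4 (proof of Lemma 4.1: "Choose a vector `t ∈ ℤ_pⁿ` uniformly at random")] -/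
def tOf (u : Fin (m + m) → (Fin n → ZMod q) × ZMod q) : Fin n → ZMod q :=
  if h : 0 < m + m then (u ⟨0, h⟩).1 else 0

/-- The self-made uniform block of a unit: `p ↦ (a_p, (a'_p)₀)` from the `a`-parts of the `p`-th
samples of its two halves. [cite: RegevLWE2009, §4 (proof of Lemma 4.1: "estimate the acceptance probability of `W` on `U`")] -/
def ublkOf (u : Fin (m + m) → (Fin n → ZMod q) × ZMod q) : Fin m → (Fin n → ZMod q) × ZMod q :=
  fun p => ((u (Fin.castAdd m p)).1, scal (u (Fin.natAdd m p)))

/-- The test block of a unit for coordinate `i`, guess `k` and shift `t`: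
`p ↦ f_t (c_{i,k,l_p} (x_p))` with `x_p` the `p`-th sample of the first half and `l_p = (a'_p)₀` from
the second half. [cite: RegevLWE2009, §4 (proofs of Lemmas 4.1–4.2)] -/
def xblkOf (i : Fin n) (k : ZMod q) (t : Fin n → ZMod q) (u : Fin (m + m) → (Fin n → ZMod q) × ZMod q) :
    Fin m → (Fin n → ZMod q) × ZMod q :=
  fun p => shiftSample t (coordSample i k (scal (u (Fin.natAdd m p))) (u (Fin.castAdd m p)))

/-- `scal` in positive dimension. [folklore] -/
theorem scal_eq (h : 0 < n) (x : (Fin n → ZMod q) × ZMod q) : scal x = x.1 ⟨0, h⟩ :=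
  dif_pos h

/-- `tOf` for nonempty units. [folklore] -/
theorem tOf_eq (h : 0 < m + m) (u : Fin (m + m) → (Fin n → ZMod q) × ZMod q) : tOf u = (u ⟨0, h⟩).1 :=
  dif_pos h

/-- `ublkOf` as split–map–zip. [folklore] -/
theorem ublkOf_eq :
    (ublkOf : (Fin (m + m) → (Fin n → ZMod q) × ZMod q) → Fin m → (Fin n → ZMod q) × ZMod q) =
      (Equiv.arrowProdEquivProdArrow (Fin m) (fun _ => Fin n → ZMod q) (fun _ => ZMod q)).symm ∘
        (Prod.map (fun v => Prod.fst ∘ v) (fun v => scal ∘ v) ∘ (Fin.appendEquiv m m).symm) :=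
  rfl

/-- `xblkOf` as split–map–swap–zip followed by Regev's transformation samplewise. [folklore] -/
theorem xblkOf_eq (i : Fin n) (k : ZMod q) (t : Fin n → ZMod q) :
    (xblkOf i k t : (Fin (m + m) → (Fin n → ZMod q) × ZMod q) → Fin m → (Fin n → ZMod q) × ZMod q) =
      (fun x => (fun y => shiftSample t (coordSample i k y.1 y.2)) ∘ x) ∘
        ((Equiv.arrowProdEquivProdArrow (Fin m) (fun _ => ZMod q) (fun _ => (Fin n → ZMod q) × ZMod q)).symm ∘
          (Prod.swap ∘ (Prod.map id (fun v => scal ∘ v) ∘ (Fin.appendEquiv m m).symm))) :=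
  rfl

/-! ### Exact laws of the extracted data under `A_{s,χ}^{2m}` -/

section Laws

variable [NeZero q] (χ : PMF (ZMod q)) (s : Fin n → ZMod q)

/-- **The scalar of an LWE sample is uniform** (`n ≥ 1`). [cite: RegevLWE2009, §2 (`a` uniform)] -/
theorem lweSample_map_scal (hn : 0 < n) : (lweSample χ s).map scal = PMF.uniformOfFintype (ZMod q) := by
  rw [show (scal : (Fin n → ZMod q) × ZMod q → ZMod q) = fun x => x.1 ⟨0, hn⟩ from funext (scal_eq hn)]
  exact lweSample_map_fst_eval χ s _

/-- **The shift vector of a unit is uniform** (`m ≥ 1`). [cite: RegevLWE2009, §4 (proof of Lemma 4.1)] -/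
theorem lweSamples_map_tOf (hm : 0 < m) :
    (lweSamples χ s (m + m)).map tOf = PMF.uniformOfFintype (Fin n → ZMod q) := by
  have h : 0 < m + m := Nat.add_pos_left hm m
  rw [show (tOf : (Fin (m + m) → (Fin n → ZMod q) × ZMod q) → Fin n → ZMod q) =
      Prod.fst ∘ fun u => u ⟨0, h⟩ from funext fun u => tOf_eq h u, ← PMF.map_comp, lweSamples,
    iidPMF_map_eval, lweSample_map_fst_eq]

/-- **The self-made uniform block of a unit is uniform**: `U^m` (`n ≥ 1`). [cite: RegevLWE2009, §4 (proof of Lemma 4.1)] -/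
theorem lweSamples_map_ublkOf (hn : 0 < n) :
    (lweSamples χ s (m + m)).map ublkOf = uniformSamples (Fin n) (ZMod q) m := by
  rw [ublkOf_eq, ← PMF.map_comp, ← PMF.map_comp, lweSamples, iidPMF_map_appendEquiv_symm, prodLaw_map_prodMap,
    iidPMF_map, iidPMF_map, lweSample_map_fst_eq, lweSample_map_scal χ s hn, prodLaw_iidPMF_map_zip,
    prodLaw_uniformOfFintype, uniformSamples_eq_iidPMF_holds]

/-- The law of the (scalar, sample) pairs of a unit is `(U_R ⊗ A_{s,χ})^{⊗m}` (`n ≥ 1`).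
[cite: RegevLWE2009, §4 (proof of Lemma 4.2)] -/
theorem lweSamples_map_pairs (hn : 0 < n) :
    (lweSamples χ s (m + m)).map
        ((Equiv.arrowProdEquivProdArrow (Fin m) (fun _ => ZMod q) (fun _ => (Fin n → ZMod q) × ZMod q)).symm ∘
          (Prod.swap ∘ (Prod.map id (fun v => scal ∘ v) ∘ (Fin.appendEquiv m m).symm))) =
      iidPMF (pairLaw (lweSample χ s)) m := by
  rw [← PMF.map_comp, ← PMF.map_comp, ← PMF.map_comp, lweSamples, iidPMF_map_appendEquiv_symm,
    prodLaw_map_prodMap, PMF.map_id, iidPMF_map, lweSample_map_scal χ s hn, prodLaw_map_swap,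
    prodLaw_iidPMF_map_zip, pairLaw_eq_prodLaw]

/-- **Correct guess: the test block is `A_{s+t,χ}^m`.** [cite: RegevLWE2009, §4 (proofs of Lemmas 4.1–4.2)] -/
theorem lweSamples_map_xblkOf_self (i : Fin n) (t : Fin n → ZMod q) :
    (lweSamples χ s (m + m)).map (xblkOf i (s i) t) = lweSamples χ (s + t) m := by
  rw [xblkOf_eq, ← PMF.map_comp, lweSamples_map_pairs χ s i.pos, iidPMF_pairLaw_map_shift_coord_self]

/-- **Wrong guess: the test block is uniform, `U^m`** (`q` prime). [cite: RegevLWE2009, §4 (proof of Lemma 4.2: "note that this requires `p` to be prime")] -/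
theorem lweSamples_map_xblkOf_of_ne [Fact (Nat.Prime q)] (i : Fin n) {k : ZMod q} (hk : k ≠ s i)
    (t : Fin n → ZMod q) :
    (lweSamples χ s (m + m)).map (xblkOf i k t) = uniformSamples (Fin n) (ZMod q) m := by
  rw [xblkOf_eq, ← PMF.map_comp, lweSamples_map_pairs χ s i.pos, iidPMF_pairLaw_map_shift_coord_of_ne χ s t i hk]

end Laws

/-! ### Parameters and the layout of the input tuple -/

/-- The parameters of the reduction: `R` shifts, `N` samples per estimate, `B` guesses per
coordinate (all of `ℤ_q` is covered when `q ≤ B`), and `D = 1/ε` for the advantage `ε` of the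
distinguisher (Regev: `n^{c₁+1}` repetitions, `O(n^{2c₂+1})` calls per estimate, `p` guesses,
`ε = n^{-c₂}`). [cite: RegevLWE2009, §4 Lemma 4.1–4.2] -/
structure Params where
  /-- number of random shifts `t_r` -/
  R : ℕ
  /-- number of oracle calls per estimate -/
  N : ℕ
  /-- number of guesses per coordinate -/
  B : ℕ
  /-- inverse advantage `D = 1/ε` -/
  D : ℕ

namespace Params

variable (P : Params)

/-- The number of test groups `G = n·B·R` (one per coordinate, guess and shift); reducible, so
that `Fin (P.groups n)` unfolds under rewriting. [folklore] -/
abbrev groups (n : ℕ) : ℕ := n * P.B * P.R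

/-- The number of units `K = R + (N + G·N)` (reducible). [folklore] -/
abbrev K (n : ℕ) : ℕ := P.R + (P.N + P.groups n * P.N)

/-- The number of input samples `m' = K · 2m` (reducible). [folklore] -/
abbrev total (n m : ℕ) : ℕ := P.K n * (m + m)

/-- The number of oracle queries `N + G·N` (reducible). [folklore] -/
abbrev numQueries (n : ℕ) : ℕ := P.N + P.groups n * P.N

/-- The coding of triples `(i, k, r)` by group indices: `((i, k), r) ↦ (i·B + k)·R + r`. [folklore] -/
def gEquiv (n : ℕ) : (Fin n × Fin P.B) × Fin P.R ≃ Fin (P.groups n) :=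
  (Equiv.prodCongr finProdFinEquiv (Equiv.refl _)).trans finProdFinEquiv

/-- The group of `(i, k, r)`. [folklore] -/
def gOf (i : Fin n) (k : Fin P.B) (r : Fin P.R) : Fin (P.groups n) :=
  P.gEquiv n ((i, k), r)

/-- The triple of a group. [folklore] -/
def ikr (g : Fin (P.groups n)) : (Fin n × Fin P.B) × Fin P.R :=
  (P.gEquiv n).symm g

/-- Decoding the group of a triple. [folklore] -/
@[simp] theorem ikr_gOf (i : Fin n) (k : Fin P.B) (r : Fin P.R) : P.ikr (P.gOf i k r) = ((i, k), r) :=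
  (P.gEquiv n).symm_apply_apply _

/-- Encoding the triple of a group. [folklore] -/
@[simp] theorem gOf_ikr (g : Fin (P.groups n)) : P.gOf (P.ikr g).1.1 (P.ikr g).1.2 (P.ikr g).2 = g :=
  (P.gEquiv n).apply_symm_apply g

/-- The group index as a number: `(i·B + k)·R + r`. [folklore] -/
theorem val_gOf (i : Fin n) (k : Fin P.B) (r : Fin P.R) :
    (P.gOf i k r).val = (i.val * P.B + k.val) * P.R + r.val := by
  show (finProdFinEquiv (finProdFinEquiv (i, k), r) : Fin (P.groups n)).val = _
  rw [val_finProdFinEquiv, val_finProdFinEquiv]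

/-- The unit of shift `r`: unit `r`. [folklore] -/
def tUnit (n : ℕ) (r : Fin P.R) : Fin (P.K n) := Fin.castAdd _ r

/-- The unit of the `j`-th uniform block: unit `R + j`. [folklore] -/
def uUnit (n : ℕ) (j : Fin P.N) : Fin (P.K n) := Fin.natAdd P.R (Fin.castAdd _ j)

/-- The unit of the `j`-th test block of group `g`: unit `R + (N + (g·N + j))`. [folklore] -/
def xUnit (g : Fin (P.groups n)) (j : Fin P.N) : Fin (P.K n) :=
  Fin.natAdd P.R (Fin.natAdd P.N (finProdFinEquiv (g, j)))

/-- `tUnit` as a number. [folklore] -/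
@[simp] theorem val_tUnit (r : Fin P.R) : (P.tUnit n r).val = r.val := rfl

/-- `uUnit` as a number. [folklore] -/
@[simp] theorem val_uUnit (j : Fin P.N) : (P.uUnit n j).val = P.R + j.val := rfl

/-- `xUnit` as a number. [folklore] -/
theorem val_xUnit (g : Fin (P.groups n)) (j : Fin P.N) : (P.xUnit g j).val = P.R + (P.N + (g.val * P.N + j.val)) := by
  simp only [xUnit, Fin.val_natAdd, val_finProdFinEquiv]

/-! ### The queries -/

section Queries

variable {P}

/-- The units of the input tuple: unit `u`, position `p` is sample `u·2m + p`. [folklore] -/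
def units (S : Fin (P.total n m) → (Fin n → ZMod q) × ZMod q) : Fin (P.K n) → Fin (m + m) → (Fin n → ZMod q) × ZMod q :=
  blocksOf (P.K n) (m + m) S

/-- The `r`-th shift vector `t_r`. [cite: RegevLWE2009, §4 (proof of Lemma 4.1)] -/
def tVec (S : Fin (P.total n m) → (Fin n → ZMod q) × ZMod q) (r : Fin P.R) : Fin n → ZMod q :=
  tOf (units S (P.tUnit n r))

/-- The `j`-th self-made uniform block. [cite: RegevLWE2009, §4 (proof of Lemma 4.1)] -/
def ublk (S : Fin (P.total n m) → (Fin n → ZMod q) × ZMod q) (j : Fin P.N) : Fin m → (Fin n → ZMod q) × ZMod q :=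
  ublkOf (units S (P.uUnit n j))

/-- The `j`-th test block of group `g = (i, k, r)`: coordinate `i`, guess `(k : ℤ_q)`, shift `t_r`.
[cite: RegevLWE2009, §4 (proofs of Lemmas 4.1–4.2)] -/
def xblk (S : Fin (P.total n m) → (Fin n → ZMod q) × ZMod q) (g : Fin (P.groups n)) (j : Fin P.N) :
    Fin m → (Fin n → ZMod q) × ZMod q :=
  xblkOf (P.ikr g).1.1 ((P.ikr g).1.2.val : ZMod q) (tVec S (P.ikr g).2) (units S (P.xUnit g j))

/-- **The `b`-th query**: the uniform blocks for `b < N`, then the test blocks, group-major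
(`b = N + (g·N + j)`); the junk block `0` past the last query. [cite: RegevLWE2009, §4 Lemma 4.1–4.2] -/
def qry (S : Fin (P.total n m) → (Fin n → ZMod q) × ZMod q) (b : ℕ) : Fin m → (Fin n → ZMod q) × ZMod q :=
  if h : b < P.N then ublk S ⟨b, h⟩
  else if h' : b - P.N < P.groups n * P.N then
    xblk S (finProdFinEquiv.symm ⟨b - P.N, h'⟩).1 (finProdFinEquiv.symm ⟨b - P.N, h'⟩).2
  else fun _ => (0, 0)

/-- **The answer bits** of an acceptance predicate `acc` (the distinguisher) on the queries.
[cite: RegevLWE2009, §4 Lemma 4.1–4.2] -/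
def bitsOf (acc : (Fin m → (Fin n → ZMod q) × ZMod q) → Bool)
    (S : Fin (P.total n m) → (Fin n → ZMod q) × ZMod q) (b : ℕ) : Bool :=
  acc (qry S b)

/-- The index of the answer bit of the `j`-th test block of group `g`: `N + (g·N + j)`. [folklore] -/
def xIdx (P : Params) (g j : ℕ) : ℕ := P.N + (g * P.N + j)

/-- The group index of a triple of numbers: `(i·B + k)·R + r`. [folklore] -/
def gIdx (P : Params) (i k r : ℕ) : ℕ := (i * P.B + k) * P.R + r

/-- `gIdx` agrees with `gOf`. [folklore] -/
theorem gIdx_eq_val_gOf (i : Fin n) (k : Fin P.B) (r : Fin P.R) : P.gIdx i.val k.val r.val = (P.gOf i k r).val := by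
  rw [val_gOf]; rfl

/-- Group indices of triples are in range. [folklore] -/
theorem gIdx_lt {i k r : ℕ} (hi : i < n) (hk : k < P.B) (hr : r < P.R) : P.gIdx i k r < P.groups n := by
  have h := (P.gOf ⟨i, hi⟩ ⟨k, hk⟩ ⟨r, hr⟩).isLt
  rwa [← gIdx_eq_val_gOf] at h

/-- Indices of test bits are query indices. [folklore] -/
theorem xIdx_lt {g j : ℕ} (hg : g < P.groups n) (hj : j < P.N) : P.xIdx g j < P.numQueries n := by
  unfold xIdx numQueries
  have h := (finProdFinEquiv (⟨g, hg⟩, ⟨j, hj⟩) : Fin (P.groups n * P.N)).isLt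
  rw [val_finProdFinEquiv] at h
  simpa using h

/-- The first `N` queries are the uniform blocks. [folklore] -/
theorem qry_lt (S : Fin (P.total n m) → (Fin n → ZMod q) × ZMod q) (j : Fin P.N) : qry S j.val = ublk S j := by
  simp [qry, j.isLt]

/-- The test queries are the test blocks. [folklore] -/
theorem qry_xIdx (S : Fin (P.total n m) → (Fin n → ZMod q) × ZMod q) (g : Fin (P.groups n)) (j : Fin P.N) :
    qry S (P.xIdx g.val j.val) = xblk S g j := by
  have hlt : g.val * P.N + j.val < P.groups n * P.N := by
    have h := (finProdFinEquiv (g, j) : Fin (P.groups n * P.N)).isLt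
    rwa [val_finProdFinEquiv] at h
  have hge : ¬ P.N + (g.val * P.N + j.val) < P.N := by omega
  simp only [qry, xIdx, hge, dif_neg, not_false_eq_true, Nat.add_sub_cancel_left, hlt, dif_pos]
  have : (⟨g.val * P.N + j.val, hlt⟩ : Fin (P.groups n * P.N)) = finProdFinEquiv (g, j) :=
    Fin.ext (by rw [val_finProdFinEquiv])
  rw [this, Equiv.symm_apply_apply]

/-- **The first `N` answer bits** are the verdicts on the uniform blocks. [folklore] -/
theorem bitsOf_lt (acc : (Fin m → (Fin n → ZMod q) × ZMod q) → Bool)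
    (S : Fin (P.total n m) → (Fin n → ZMod q) × ZMod q) (j : Fin P.N) :
    bitsOf acc S j.val = acc (ublk S j) := by
  simp [bitsOf, qry, j.isLt]

/-- **The test answer bits** are the verdicts on the test blocks. [folklore] -/
theorem bitsOf_xIdx (acc : (Fin m → (Fin n → ZMod q) × ZMod q) → Bool)
    (S : Fin (P.total n m) → (Fin n → ZMod q) × ZMod q) (g : Fin (P.groups n)) (j : Fin P.N) :
    bitsOf acc S (P.xIdx g.val j.val) = acc (xblk S g j) := by
  rw [bitsOf, qry_xIdx]

end Queries

/-! ### The decision rule on an answer sequence -/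

/-- The count of accepted uniform blocks: `cU = #{j < N | bit j}` (as a sum of `0/1`, the form a
counting loop produces). [cite: RegevLWE2009, §4 (proof of Lemma 4.1: "estimate the acceptance probability of `W` on `U`")] -/
def cntU (bits : ℕ → Bool) : ℕ := ∑ j ∈ Finset.range P.N, (bits j).toNat

/-- The count of accepted test blocks of the triple `(i, k, r)`. [cite: RegevLWE2009, §4 (proof of Lemma 4.1: "and on `f_t(R)`")] -/
def cntX (bits : ℕ → Bool) (i k r : ℕ) : ℕ :=
  ∑ j ∈ Finset.range P.N, (bits (P.xIdx (P.gIdx i k r) j)).toNat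

/-- Two counts out of `N` are FAR if the frequencies differ by at least `ε/4 = 1/(4D)`:
`N ≤ 4 D |A - C|`. [cite: RegevLWE2009, §4 (proof of Lemma 4.1: "If the two estimates differ by more than `n^{-c₂}/2` then we … accept")] -/
def far (A C : ℕ) : Bool := decide (P.N ≤ 4 * P.D * ((A : ℤ) - C).natAbs)

/-- Guess `k` for coordinate `i` PASSES if for some shift `r < R` the counts are far.
[cite: RegevLWE2009, §4 (proof of Lemma 4.2: "using `W` we can test whether `k = s₁`")] -/
def passes (bits : ℕ → Bool) (i k : ℕ) : Bool :=
  (List.range P.R).any fun r => P.far (P.cntX bits i k r) (P.cntU bits)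

/-- The guess for coordinate `i`: the least passing `k < B` (junk `0` if none).
[cite: RegevLWE2009, §4 (proof of Lemma 4.2: "only `p` possibilities for `s₁` … try all of them")] -/
def guess (bits : ℕ → Bool) (i : ℕ) : ℕ :=
  ((List.range P.B).find? fun k => P.passes bits i k).getD 0

/-- **The decision rule**: the guessed secret `(guess i : ℤ_q)_{i<n}` read off an answer sequence.
[cite: RegevLWE2009, §4 Lemma 4.2] -/
def solveBits (n q : ℕ) (bits : ℕ → Bool) : Fin n → ZMod q :=
  fun i => ((P.guess bits i.val : ℕ) : ZMod q)

/-- **The search-LWE solver of the reduction** with the acceptance predicate `acc` as distinguisher: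
form the queries from the input tuple, collect the verdicts, decide. [cite: RegevLWE2009, §4 Lemma 4.1–4.2] -/
def solve {P : Params} (acc : (Fin m → (Fin n → ZMod q) × ZMod q) → Bool)
    (S : Fin (P.total n m) → (Fin n → ZMod q) × ZMod q) : Fin n → ZMod q :=
  P.solveBits n q (bitsOf acc S)

/-- The counts only read answer bits of actual queries: `cntU`. [folklore] -/
theorem cntU_congr {bits bits' : ℕ → Bool} (h : ∀ b < P.numQueries n, bits b = bits' b) :
    P.cntU bits = P.cntU bits' := by
  unfold cntU
  refine Finset.sum_congr rfl fun j hj => ?_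
  rw [h j (lt_of_lt_of_le (Finset.mem_range.1 hj) (Nat.le_add_right _ _))]

/-- The counts only read answer bits of actual queries: `cntX` for triples in range. [folklore] -/
theorem cntX_congr {bits bits' : ℕ → Bool} (h : ∀ b < P.numQueries n, bits b = bits' b) {i k r : ℕ}
    (hi : i < n) (hk : k < P.B) (hr : r < P.R) : P.cntX bits i k r = P.cntX bits' i k r := by
  unfold cntX
  refine Finset.sum_congr rfl fun j hj => ?_
  rw [h _ (xIdx_lt (gIdx_lt hi hk hr) (Finset.mem_range.1 hj))]

/-- `passes` only reads answer bits of actual queries. [folklore] -/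
theorem passes_congr {bits bits' : ℕ → Bool} (h : ∀ b < P.numQueries n, bits b = bits' b) {i k : ℕ}
    (hi : i < n) (hk : k < P.B) : P.passes bits i k = P.passes bits' i k := by
  rw [Bool.eq_iff_iff, passes, passes, List.any_eq_true, List.any_eq_true]
  constructor <;> rintro ⟨r, hr, hfar⟩ <;> refine ⟨r, hr, ?_⟩
  · rwa [← P.cntX_congr h hi hk (List.mem_range.1 hr), ← P.cntU_congr h]
  · rwa [P.cntX_congr h hi hk (List.mem_range.1 hr), P.cntU_congr h]

/-- `guess` only reads answer bits of actual queries. [folklore] -/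
theorem guess_congr {bits bits' : ℕ → Bool} (h : ∀ b < P.numQueries n, bits b = bits' b) {i : ℕ} (hi : i < n) :
    P.guess bits i = P.guess bits' i := by
  unfold guess
  rw [List.find?_congr fun k hk => P.passes_congr h hi (List.mem_range.1 hk)]

/-- **The decision rule only reads the answer bits of actual queries.** [folklore] -/
theorem solveBits_congr {bits bits' : ℕ → Bool} (h : ∀ b < P.numQueries n, bits b = bits' b) :
    P.solveBits n q bits = P.solveBits n q bits' :=
  funext fun i => by rw [solveBits, solveBits, P.guess_congr h i.isLt]

end Params

end DecisionToSearch

end LWE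

end Literature.Computability.Cryptography

end
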